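import Mathlib
import Summits.Ventures.PercRepro2.SepSplitDeadDsym

/-!
# Gluing at a general separator, XVII: the doubly symmetrised kernel is the ONLY dead clause —
the extended dead clause `DeadX` and the rule through `DsymZero` (blind cell PercRepro2, mine-2
g50, 2026-08-29; `conjectures/MINE-2.md` M2-104)

`SepSplitDeadDsym` shows the six mechanisms of `Dead` are doubly-symmetrised zero
(`dsymZero_of_dead`).  The two pointwise deaths of `SepSplitCoincide` — the `o`–`a₃` coincidence
with equal columns in all three far data and the `pd`-dead triples — are pointwise in `KB` itself,
hence in the symmetrised kernel on every assignment (`KBsym_eq_zero_of_coincide`,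
`KBsym_eq_zero_of_pdB3`) and doubly-symmetrised zero too (`dsymZero_of_coincide03`,
`dsymZero_of_pdDead`).  All eight are collected as `DeadX`, with `dsymZero_of_deadX` and
`orbitRootS_eq_zero_of_deadX`.  Hence the rule and the locus that read on the non-`DsymZero`
orbits (`SepSplitDsym`) subsume every rule on live orbits the kernel holds:
`typedCount_nonneg_of_sepSplit_realised_deadX` (row 2′TRI at any split from the realised orbits
outside the extended dead clause) and `typedCount_eq_zero_iff_of_sepSplit_deadX` — `DsymZero` is
the only dead clause the kernel needs.  The census of M2-103 (kit j333492) is the numerical twin: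
on 2,011,520 orbit–configuration pairs the never-nonzero orbits are exactly the `DsymZero` ones,
0 violations.  Own work; standard axioms.
-/

namespace Summit.Ventures.PercRepro2

open UnionCluster

namespace CovForm

namespace RootBridge

open OneTyped TypedA3 Untouched TypedFactor Separated

/-! ## The two pointwise deaths and the extended dead clause -/

section DeadX

open Classical

variable {ι : Type*}

/-- Under equal columns in all three far data, every datum of the triple has equal columns. -/
lemma eqCols03_inTriple {p : Pat3S ι} (hp : EqCols03 p.1 ∧ EqCols03 p.2.1 ∧ EqCols03 p.2.2)
    {q : SideData ι} (hq : q = p.1 ∨ q = p.2.1 ∨ q = p.2.2) : EqCols03 q := by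
  rcases hq with rfl | rfl | rfl
  · exact hp.1
  · exact hp.2.1
  · exact hp.2.2

/-- Under `Joins3` in all three far data, every datum of the triple joins `a₃` to a far root. -/
lemma joins3_inTriple {side : Fin 5 → Bool} {p : Pat3S ι}
    (hp : Joins3 side p.1 ∧ Joins3 side p.2.1 ∧ Joins3 side p.2.2) {q : SideData ι}
    (hq : q = p.1 ∨ q = p.2.1 ∨ q = p.2.2) : Joins3 side q := by
  rcases hq with rfl | rfl | rfl
  · exact hp.1
  · exact hp.2.1
  · exact hp.2.2

/-- **The `o`–`a₃` coincidence ⟹ doubly-symmetrised zero** (pointwise in `KB` itself). -/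
theorem dsymZero_of_coincide03 (side : Fin 5 → Bool) (h0 : side 0 = true) (h3 : side 3 = true)
    (p : Pat3S ι) (hp : EqCols03 p.1 ∧ EqCols03 p.2.1 ∧ EqCols03 p.2.2) : DsymZero side p :=
  dsymZero_of_inTriple side p fun hx hy hw _ _ _ m1 m2 m3 =>
    KBsym_eq_zero_of_coincide _ _ _
      (gluedS_coincide_of_eqCols03 hx _ side h0 h3 (eqCols03_inTriple hp m1))
      (gluedS_coincide_of_eqCols03 hy _ side h0 h3 (eqCols03_inTriple hp m2))
      (gluedS_coincide_of_eqCols03 hw _ side h0 h3 (eqCols03_inTriple hp m3))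

/-- **`pd`-dead ⟹ doubly-symmetrised zero** (pointwise in `KB` itself). -/
theorem dsymZero_of_pdDead (side : Fin 5 → Bool) (h3 : side 3 = true) (p : Pat3S ι)
    (hp : Joins3 side p.1 ∧ Joins3 side p.2.1 ∧ Joins3 side p.2.2) : DsymZero side p :=
  dsymZero_of_inTriple side p fun hx hy hw _ _ _ m1 m2 m3 =>
    KBsym_eq_zero_of_pdB3 _ _ _
      (gluedS_pdB_of_joined3 hx _ side h3 (joins3_inTriple hp m1))
      (gluedS_pdB_of_joined3 hy _ side h3 (joins3_inTriple hp m2))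
      (gluedS_pdB_of_joined3 hw _ side h3 (joins3_inTriple hp m3))

/-- **The extended dead clause**: the six mechanisms of `Dead` and the two pointwise deaths of
`SepSplitCoincide` (the `o`–`a₃` coincidence with `o, a₃` both far; `pd`-dead with `a₃` far). -/
def DeadX (side : Fin 5 → Bool) (p : Pat3S ι) : Prop :=
  Dead side p ∨
    (side 0 = true ∧ side 3 = true ∧ EqCols03 p.1 ∧ EqCols03 p.2.1 ∧ EqCols03 p.2.2) ∨
    (side 3 = true ∧ Joins3 side p.1 ∧ Joins3 side p.2.1 ∧ Joins3 side p.2.2)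

/-- **Every mechanism of the extended dead clause is doubly-symmetrised zero.** -/
theorem dsymZero_of_deadX (side : Fin 5 → Bool) (p : Pat3S ι) (hd : DeadX side p) :
    DsymZero side p := by
  rcases hd with hd | ⟨h0, h3, c1, c2, c3⟩ | ⟨h3, j1, j2, j3⟩
  · exact dsymZero_of_dead side p hd
  · exact dsymZero_of_coincide03 side h0 h3 p ⟨c1, c2, c3⟩
  · exact dsymZero_of_pdDead side h3 p ⟨j1, j2, j3⟩

/-- A triple that is not doubly-symmetrised zero is not dead in any of the eight ways: the
non-`DsymZero` orbits are a subset of the live orbits. -/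
theorem not_deadX_of_not_dsymZero (side : Fin 5 → Bool) (p : Pat3S ι) (h : ¬ DsymZero side p) :
    ¬ DeadX side p := fun hd => h (dsymZero_of_deadX side p hd)

end DeadX

/-! ## The rule and the locus on the non-`DeadX` orbits, through the doubly symmetrised kernel -/

section Rule

open Classical

variable {V : Type*} {E : Type*} {ι : Type*} [Fintype E] [DecidableEq E] [Fintype ι]
  [DecidableEq ι] {R : Type*} [Field R] [LinearOrder R] [IsStrictOrderedRing R]
variable (ends : E → Sym2 V) (mk : Fin 5 → V) (σ : ι → V)

omit [Fintype ι] [DecidableEq ι] in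
/-- **Every triple of the extended dead clause has orbit sum zero** on every root side (types in
`{1, 2}`), realised or not — the eight mechanisms through the one criterion. -/
theorem orbitRootS_eq_zero_of_deadX (side : Fin 5 → Bool) (VH : Set V) (B : Finset E)
    (z : Config E) (τ : E → ℕ) (hτ : ∀ e ∈ B, τ e = 1 ∨ τ e = 2) (p : Pat3S ι)
    (hd : DeadX side p) : orbitRootS ends mk σ side VH B z τ p = (0 : R) :=
  orbitRootS_eq_zero_of_dsymZero ends mk σ side VH B z τ hτ p (dsymZero_of_deadX side p hd)

/-- **Row 2′TRI at any split, from the realised orbits outside the extended dead clause** — a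
consequence of the `DsymZero` rule, since every `DeadX` triple is `DsymZero`. -/
theorem typedCount_nonneg_of_sepSplit_realised_deadX {side : Fin 5 → Bool} {VL VH : Set V}
    (F : Finset E) (z : Config E) (τ : E → ℕ) (hτ : ∀ e ∈ F, τ e = 1 ∨ τ e = 2)
    (h : SepSplit ends mk σ side VL VH F z)
    (hroot : ∀ p : Pat3S ι,
      typedCount (sideF ends VL F) z τ
          (farKS ends mk σ VL p : Config E → Config E → Config E → R) ≠ 0 →
      ¬ DeadX side p → (0 : R) ≤ orbitRootS ends mk σ side VH (sideF ends VH F) z τ p) :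
    0 ≤ typedCount F z τ
      (K3 ends (mk 0) (mk 1) (mk 2) (mk 3) (mk 4) : Config E → Config E → Config E → R) :=
  typedCount_nonneg_of_sepSplit_realised_dsym ends mk σ F z τ hτ h fun p hp hnd =>
    hroot p hp (not_deadX_of_not_dsymZero side p hnd)

/-- **The equality locus at any split, on the orbits outside the extended dead clause** (under the
sign hypothesis on the realised non-`DsymZero` orbits): `N = 0` ⟺ every realised non-`DsymZero`
orbit sum is `0` ⟹ every realised non-`DeadX` orbit sum outside `DsymZero` is `0`. -/
theorem typedCount_eq_zero_iff_of_sepSplit_deadX {side : Fin 5 → Bool} {VL VH : Set V}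
    (F : Finset E) (z : Config E) (τ : E → ℕ) (hτ : ∀ e ∈ F, τ e = 1 ∨ τ e = 2)
    (h : SepSplit ends mk σ side VL VH F z)
    (hroot : ∀ p : Pat3S ι,
      typedCount (sideF ends VL F) z τ
          (farKS ends mk σ VL p : Config E → Config E → Config E → R) ≠ 0 →
      ¬ DeadX side p → (0 : R) ≤ orbitRootS ends mk σ side VH (sideF ends VH F) z τ p) :
    typedCount F z τ
        (K3 ends (mk 0) (mk 1) (mk 2) (mk 3) (mk 4) : Config E → Config E → Config E → R) = 0 ↔
      ∀ p : Pat3S ι,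
        typedCount (sideF ends VL F) z τ
            (farKS ends mk σ VL p : Config E → Config E → Config E → R) ≠ 0 →
          ¬ DsymZero side p →
            orbitRootS ends mk σ side VH (sideF ends VH F) z τ p = (0 : R) :=
  typedCount_eq_zero_iff_of_sepSplit_dsym ends mk σ F z τ hτ h fun p hp hnd =>
    hroot p hp (not_deadX_of_not_dsymZero side p hnd)

end Rule

end RootBridge

end CovForm

end Summit.Ventures.PercRepro2
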